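import Mathlib.Analysis.SpecialFunctions.ImproperIntegrals
import Mathlib.MeasureTheory.Integral.IntegralEqImproper
import Mathlib.Analysis.SpecialFunctions.Integrals.Basic
import HarnessLib

/-!
# The logarithmic integral `∫₁^∞ (1 - e^{-σ/t}) dt/t = log σ + L + o(1)`

Topic `Literature/Probability/LatticeModels` (real-analysis input of the asymptotics of the planar
potential kernel, `LatticePotentialKernelAsymptotics.lean`). The Gaussian main term of the
heat-kernel representation `a(x) = ∫₀^∞ (q_t(0)² - q_t(x₀)q_t(x₁)) dt` of the potential kernel is
`∫₁^∞ (φ_t(0)² - φ_t(x₀)φ_t(x₁)) dt = (2π)⁻¹ ∫₁^∞ (1 - e^{-|x|²/2t}) dt/t`, and the logarithm in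
`a(x) = (1/π) log|x| + κ + o(1)` (Lawler–Limic 2010, Thm. 4.4.4; Stöhr 1950) is the growth of

  `F(σ) = ∫₁^∞ (1 - e^{-σ/t}) dt/t`   as `σ → ∞`.

PROVED here: **`tendsto_logIntegral_sub_log`** — `F(σ) - log σ → L` as `σ → ∞`, with the explicit
constant `L = ∫₁^∞ (1 - e^{-1/u}) du/u - ∫₀¹ e^{-1/u} du/u` (`logIntegralConst`). Proof: the
scaling `t = σu` gives `F(σ) = ∫_{1/σ}^∞ (1 - e^{-1/u}) du/u` (`logIntegral_eq`); on `(1/σ, 1]`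
the integrand is `1/u - e^{-1/u}/u`, the first piece integrating to `log σ`, the second converging
to `∫₀¹ e^{-1/u} du/u` by monotone convergence of the domains (`e^{-1/u}/u ≤ 1` on `(0,1]`).
Elementary real analysis, [folklore]; no named fact.

## References

* G. F. Lawler, V. Limic, *Random Walk: A Modern Introduction* (2010), Thm. 4.4.4 and its proof
  (the logarithm from `∫ (1 - e^{-r²/2t}) dt/t`) [LawlerLimic2010].
-/

noncomputable section

open MeasureTheory Set Filter Real
open scoped Topology

namespace Literature.Probability.LatticeModels

/-! ### The scaled integrand `g(u) = (1 - e^{-1/u})/u` and the tail integrand `e^{-1/u}/u` -/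

/-- `g(u) = (1 - e^{-1/u})/u`, the integrand of `F` after the scaling `t = σ u`. [folklore] -/
def logScaledIntegrand (u : ℝ) : ℝ := (1 - Real.exp (-u⁻¹)) / u

/-- `e(u) = e^{-1/u}/u`, the part of `1/u - g(u)` on `(0, 1]`. [folklore] -/
def logTailIntegrand (u : ℝ) : ℝ := Real.exp (-u⁻¹) / u

/-- `g = 1/u - e` off `u = 0`. [folklore] -/
theorem logScaledIntegrand_eq_inv_sub (u : ℝ) :
    logScaledIntegrand u = u⁻¹ - logTailIntegrand u := by
  rw [logScaledIntegrand, logTailIntegrand, sub_div, one_div]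

/-- `g` is continuous on `(0, ∞)`. [folklore] -/
theorem continuousOn_logScaledIntegrand : ContinuousOn logScaledIntegrand (Ioi 0) := by
  refine ContinuousOn.div ?_ continuousOn_id fun u hu => (ne_of_gt hu)
  exact (continuousOn_const.sub ((Real.continuous_exp.comp_continuousOn
    ((continuousOn_inv₀.mono fun u hu => ne_of_gt hu).neg))))

/-- `e` is continuous on `(0, ∞)`. [folklore] -/
theorem continuousOn_logTailIntegrand : ContinuousOn logTailIntegrand (Ioi 0) := by
  refine ContinuousOn.div ?_ continuousOn_id fun u hu => (ne_of_gt hu)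
  exact Real.continuous_exp.comp_continuousOn
    ((continuousOn_inv₀.mono fun u hu => ne_of_gt hu).neg)

/-- `0 ≤ g(u) ≤ u⁻²` for `u > 0` (`1 - e^{-1/u} ≤ 1/u`). [folklore] -/
theorem logScaledIntegrand_nonneg_and_le {u : ℝ} (hu : 0 < u) :
    0 ≤ logScaledIntegrand u ∧ logScaledIntegrand u ≤ u ^ (-2 : ℝ) := by
  have h1 : Real.exp (-u⁻¹) ≤ 1 := Real.exp_le_one_iff.2 (by simp [hu.le])
  have h2 : 1 - Real.exp (-u⁻¹) ≤ u⁻¹ := by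
    have := Real.add_one_le_exp (-u⁻¹)
    linarith
  refine ⟨div_nonneg (by linarith) hu.le, ?_⟩
  rw [logScaledIntegrand, div_le_iff₀ hu]
  calc 1 - Real.exp (-u⁻¹) ≤ u⁻¹ := h2
    _ = u ^ (-2 : ℝ) * u := by
        rw [show (-2 : ℝ) = -1 + -1 by norm_num, Real.rpow_add hu, Real.rpow_neg_one, mul_assoc,
          inv_mul_cancel₀ hu.ne', mul_one]

/-- `0 ≤ e(u) ≤ 1` for `0 < u` (`e^{1/u} ≥ 1/u`). [folklore] -/
theorem logTailIntegrand_nonneg_and_le_one {u : ℝ} (hu : 0 < u) :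
    0 ≤ logTailIntegrand u ∧ logTailIntegrand u ≤ 1 := by
  refine ⟨div_nonneg (Real.exp_pos _).le hu.le, ?_⟩
  rw [logTailIntegrand, div_le_one hu, Real.exp_neg, inv_le_comm₀ (Real.exp_pos _) hu]
  have := Real.add_one_le_exp u⁻¹
  have h0 : 0 < u⁻¹ := inv_pos.2 hu
  linarith

/-- `g` is integrable on `(a, ∞)` for `a > 0` (majorant `u⁻²`). [folklore] -/
theorem integrableOn_logScaledIntegrand {a : ℝ} (ha : 0 < a) :
    IntegrableOn logScaledIntegrand (Ioi a) := by
  have hmaj := integrableOn_Ioi_rpow_of_lt (show (-2 : ℝ) < -1 by norm_num) ha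
  refine hmaj.mono' ?_ ?_
  · exact (continuousOn_logScaledIntegrand.mono fun u hu => ha.trans hu).aestronglyMeasurable
      measurableSet_Ioi
  · filter_upwards [ae_restrict_mem measurableSet_Ioi] with u hu
    have hu0 : 0 < u := ha.trans hu
    obtain ⟨h0, h1⟩ := logScaledIntegrand_nonneg_and_le hu0
    rw [Real.norm_eq_abs, abs_of_nonneg h0]
    exact h1

/-- `e` is integrable on `(0, 1]` (bounded by `1`). [folklore] -/
theorem integrableOn_logTailIntegrand : IntegrableOn logTailIntegrand (Ioc 0 1) := by
  have hmeas : Measurable logTailIntegrand := by unfold logTailIntegrand; fun_prop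
  refine Measure.integrableOn_of_bounded (measure_Ioc_lt_top (a := (0 : ℝ)) (b := 1)).ne
    hmeas.aestronglyMeasurable (M := 1) ?_
  filter_upwards [ae_restrict_mem measurableSet_Ioc] with u hu
  obtain ⟨h0, h1⟩ := logTailIntegrand_nonneg_and_le_one hu.1
  rw [Real.norm_eq_abs, abs_of_nonneg h0]
  exact h1

/-- `e` is integrable on `(a, 1]` for `0 ≤ a`. [folklore] -/
theorem integrableOn_logTailIntegrand_Ioc {a : ℝ} (ha : 0 ≤ a) :
    IntegrableOn logTailIntegrand (Ioc a 1) :=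
  integrableOn_logTailIntegrand.mono_set (Ioc_subset_Ioc_left ha)

/-! ### The logarithmic integral and its scaling -/

/-- `F(σ) = ∫₁^∞ (1 - e^{-σ/t}) dt/t`. [folklore] -/
def logIntegral (σ : ℝ) : ℝ := ∫ t in Ioi (1 : ℝ), (1 - Real.exp (-(σ / t))) / t

/-- **Scaling**: `F(σ) = ∫_{1/σ}^∞ (1 - e^{-1/u}) du/u` for `σ > 0` (`t = σ u`). [folklore] -/
theorem logIntegral_eq {σ : ℝ} (hσ : 0 < σ) :
    logIntegral σ = ∫ u in Ioi σ⁻¹, logScaledIntegrand u := by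
  have hpt : ∀ t : ℝ, (1 - Real.exp (-(σ / t))) / t = σ⁻¹ * logScaledIntegrand (σ⁻¹ * t) := by
    intro t
    rw [logScaledIntegrand, mul_inv, inv_inv]
    rcases eq_or_ne t 0 with rfl | ht
    · simp
    · field_simp
  rw [logIntegral]
  simp_rw [hpt]
  rw [integral_const_mul, integral_comp_mul_left_Ioi logScaledIntegrand 1 (inv_pos.2 hσ),
    mul_one, smul_eq_mul, inv_inv, ← mul_assoc, inv_mul_cancel₀ hσ.ne', one_mul]

/-- For `σ ≥ 1`: `F(σ) - log σ = ∫₁^∞ g - ∫_{1/σ}^1 e^{-1/u} du/u`. [folklore] -/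
theorem logIntegral_sub_log_eq {σ : ℝ} (hσ : 1 ≤ σ) :
    logIntegral σ - Real.log σ =
      (∫ u in Ioi (1 : ℝ), logScaledIntegrand u) - ∫ u in Ioc σ⁻¹ 1, logTailIntegrand u := by
  have hσ0 : 0 < σ := by linarith
  have hinv0 : 0 < σ⁻¹ := inv_pos.2 hσ0
  have hinv1 : σ⁻¹ ≤ 1 := inv_le_one_of_one_le₀ hσ
  rw [logIntegral_eq hσ0]
  -- split `(1/σ, ∞) = (1/σ, 1] ∪ (1, ∞)`
  have hg : IntegrableOn logScaledIntegrand (Ioi σ⁻¹) := integrableOn_logScaledIntegrand hinv0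
  rw [← Ioc_union_Ioi_eq_Ioi hinv1, setIntegral_union Ioc_disjoint_Ioi_same measurableSet_Ioi
    (hg.mono_set Ioc_subset_Ioi_self) (hg.mono_set (Ioi_subset_Ioi hinv1))]
  -- on `(1/σ, 1]`: `g = 1/u - e`
  have he : IntegrableOn logTailIntegrand (Ioc σ⁻¹ 1) := integrableOn_logTailIntegrand_Ioc hinv0.le
  have hinvI : IntegrableOn (fun u : ℝ => u⁻¹) (Ioc σ⁻¹ 1) := by
    have h := intervalIntegral.intervalIntegrable_inv (μ := volume) (a := σ⁻¹) (b := 1)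
      (f := fun u : ℝ => u) (fun x hx => ?_) continuousOn_id
    · exact h.1
    · rw [uIcc_of_le hinv1] at hx
      exact ne_of_gt (hinv0.trans_le hx.1)
  have hIoc : ∫ u in Ioc σ⁻¹ 1, logScaledIntegrand u = Real.log σ - ∫ u in Ioc σ⁻¹ 1, logTailIntegrand u := by
    simp_rw [logScaledIntegrand_eq_inv_sub]
    rw [integral_sub hinvI he, ← intervalIntegral.integral_of_le hinv1, integral_inv_of_pos hinv0 one_pos,
      one_div, inv_inv]
  rw [hIoc]
  ring

/-- The constant `L = ∫₁^∞ (1 - e^{-1/u}) du/u - ∫₀¹ e^{-1/u} du/u` of the logarithmic integral.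
[folklore] -/
def logIntegralConst : ℝ :=
  (∫ u in Ioi (1 : ℝ), logScaledIntegrand u) - ∫ u in Ioc (0 : ℝ) 1, logTailIntegrand u

/-- **`F(σ) - log σ → L` as `σ → ∞`.** [folklore] -/
theorem tendsto_logIntegral_sub_log :
    Tendsto (fun σ : ℝ => logIntegral σ - Real.log σ) atTop (𝓝 logIntegralConst) := by
  -- the tail integrals over the increasing domains `(1/max(σ,1), 1] ↑ (0, 1]`
  set s : ℝ → Set ℝ := fun σ => Ioc (max σ 1)⁻¹ 1 with hs
  have hmono : Monotone s := by
    intro σ σ' h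
    refine Ioc_subset_Ioc (inv_anti₀ (by positivity) (max_le_max_right 1 h)) le_rfl
  have hU : (⋃ σ, s σ) = Ioc 0 1 := by
    ext u
    simp only [mem_iUnion, hs, mem_Ioc]
    constructor
    · rintro ⟨σ, h1, h2⟩
      exact ⟨(inv_pos.2 (by positivity)).trans h1, h2⟩
    · rintro ⟨h1, h2⟩
      refine ⟨u⁻¹ + 1, ?_, h2⟩
      have hu1 : 1 ≤ u⁻¹ + 1 := by have := inv_pos.2 h1; linarith
      rw [max_eq_left hu1]
      calc (u⁻¹ + 1)⁻¹ < (u⁻¹)⁻¹ := inv_strictAnti₀ (inv_pos.2 h1) (by linarith)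
        _ = u := inv_inv u
  have htail : Tendsto (fun σ => ∫ u in s σ, logTailIntegrand u) atTop
      (𝓝 (∫ u in Ioc (0 : ℝ) 1, logTailIntegrand u)) := by
    have h := tendsto_setIntegral_of_monotone (μ := volume) (f := logTailIntegrand)
      (fun σ => (measurableSet_Ioc : MeasurableSet (s σ))) hmono (by rw [hU]; exact integrableOn_logTailIntegrand)
    rwa [hU] at h
  have hlim : Tendsto (fun σ => (∫ u in Ioi (1 : ℝ), logScaledIntegrand u) - ∫ u in s σ, logTailIntegrand u)
      atTop (𝓝 logIntegralConst) := tendsto_const_nhds.sub htail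
  refine hlim.congr' ?_
  filter_upwards [eventually_ge_atTop (1 : ℝ)] with σ hσ
  rw [logIntegral_sub_log_eq hσ, hs]
  simp only [max_eq_left hσ]

end Literature.Probability.LatticeModels
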